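import Literature.MathematicalPhysics.QuantumFieldTheory.QuasiLocalGaugePerturbationJointCells
import Literature.MathematicalPhysics.QuantumFieldTheory.QuasiLocalGaugePerturbationDecouplingMarkov
import Literature.MathematicalPhysics.QuantumFieldTheory.QuasiLocalGaugePerturbationDecouplingMarginal
import Literature.MathematicalPhysics.QuantumFieldTheory.QuasiLocalGaugePerturbationCells
import Literature.Probability.LatticeModels.CoarseCellMixingPeierls
import Literature.Probability.LatticeModels.CoarseCellMixingDefectsSteps
import Literature.Probability.LatticeModels.CoarseCellMixingDefectsBlockLeak
import Literature.Probability.LatticeModels.CoarseCellMixingDLR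
import HarnessLib

/-!
# Quasi-local gauge-invariant perturbations, VIII: the two-species hypotheses of a dressed gauge
# measure (instantiation of `CoarseCellHyperDefects` on the decoupled joint system)

Theorems-only file. For a perturbation `W` of a lattice gauge action read through coarse cells
(`cell : Edge d N → CoarseIdx μ`, at most `K` blocks per cell, cells contracting block nearness),
the joint `(U, mark)` system of the Bernoulli decoupling of its far polymers
(`QuasiLocalGaugePerturbationDecoupling*`, `…JointCells`) satisfies the hypotheses of the
two-species coarse-cell engine (`CoarseCellHyperDefects`):

* `isHyperMarkov_jointSpec` — the hyper-Markov property (from `integral_jointSpec_eq_of_exterior`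
  and the cell geometry);
* `isGoodFSHyper_jointSpec` — the good-exterior finite-size condition at threshold
  `ε + 2 (exp (ε₁ (4n+1)^d) - 1)`, `ε₁ = 2ηK`, from `IsGoodFS` of WILSON's kernels (the
  `U`-marginal of a joint kernel is a dressed kernel, `integral_comp_uOf_jointSpec`, which is
  locally absolutely continuous w.r.t. Wilson's, `isLocallyAC_kernel_of_card_le`);
* `hyperPeierls_jointSpec` — the two-species Peierls bound at levels `(e^{3^d ε₁} p, r)` from the
  kernel-uniform Peierls bound of Wilson's kernels (`kernel_allBad_le_of_uniformKernelPeierls`) and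
  the rarity of active marks (`jointSpec_preimage_uOf_inter_allActive_le`);
* `kp_sum_jrar_le` — the Kotecký–Preiss smallness of the second species, `≤ 2(1+e²) K η` per cell
  for `κ ≥ 3^d λ`, from `‖W‖_{b,κ} ≤ η`;
* `markRarity_jointSpec` — unconditional rarity of active marks (F2);
* `abs_cov_le_of_joint_cov` — covariances under `μ_{β,W}` are covariances under the joint measure
  (`map_uOf_jointMeasure`);
* `dressed_covariance_decay_of_hyperEngine` — hence a two-species engine (covariance form, stated as
  an explicit hypothesis) gives exponential clustering of `μ_{β,W}` with constants uniform in the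
  dressing: the statement `DressedGaugeEngine` of the RobustYangMills crux line, with the engine
  isolated as pure coarse-cell probability.

## References

* R. L. Dobrushin, S. B. Shlosman (1985), §2; J. van den Berg, C. Maes, Ann. Probab. 22 (1994);
  H.-O. Georgii, *Gibbs Measures and Phase Transitions* (2011), Ch. 8; R. Kotecký, D. Preiss,
  CMP 103 (1986); T. Bałaban, CMP 119 (1988) p. 259–261.
-/

noncomputable section

open MeasureTheory Finset
open scoped ENNReal
open Literature.Probability.LatticeModels (CoarseIdx cdist cdist_self cdist_triangle shellCount
  cellCount IsGoodFS IsLocallyAC UniformKernelPeierls glueWith glueWith_apply_mem glueWith_apply_not_mem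
  measurable_glueWith Specification IsSpecification IsGibbsMeasure hvol mem_hvol NoCrossing IsHyperMarkov
  IsGoodFSHyper HyperPeierls MarkRarity kernel_allBad_le_of_uniformKernelPeierls mem_good_of_cell_empty
  abs_sub_le_sub_one_mul_of_le_mul abs_covariance_le_integral_abs integral_abs_kernel_sub_rescale
  kernel_integral_mul_of_dependsOn)
open Literature.MathematicalPhysics.QuantumLattice

namespace Literature.MathematicalPhysics.QuantumFieldTheory

namespace QuasiLocalGaugePerturbation

variable {d N : ℕ} [NeZero N] {G : Type*} [Group G] [MeasurableSpace G] {b : ℕ} {μc : Fin d → ℕ}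
  (W : QuasiLocalGaugePerturbation d N G b)
  [TopologicalSpace G] [IsTopologicalGroup G] [CompactSpace G] [BorelSpace G]
  {Nρ : ℕ} (ρ : G →* Matrix (Fin Nρ) (Fin Nρ) ℂ) (hρ : Continuous ρ) [SecondCountableTopology G]

/-! ### The hyper-Markov property -/

include hρ in
/-- **The joint kernels are hyper-Markov** through any cell labelling that contracts block
nearness (links whose blocks are `1`-near lie in cells at coarse distance `≤ 1`). [folklore] -/
theorem isHyperMarkov_jointSpec (hb : 1 ≤ b) (β : ℝ) (cell : Edge d N → CoarseIdx μc)
    (hgeo : ∀ (D : ℕ) (e e' : Edge d N),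
      (∀ i, (blockCorner b e'.1 i - blockCorner b e.1 i).val ≤ b * (2 * D + 1) ∨
        (blockCorner b e.1 i - blockCorner b e'.1 i).val ≤ b * (2 * D + 1)) →
      cdist (cell e') (cell e) ≤ D + 1) :
    IsHyperMarkov (jcell cell) (jterr (b := b) cell) jact (W.jointSpec ρ β) := by
  intro A ζ ζ' hag hNC hNC' f hf hf01 hdep
  rw [hvol_jterr] at hdep ⊢
  refine W.integral_jointSpec_eq_of_exterior ρ hρ hb β (linksIn cell A) (marksIn cell A)
    (R := (linksIn cell A).image fun e => blockCorner b e.1) (fun e he => Finset.mem_image_of_mem _ he)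
    (fun X hX => polymerEdges_subset_linksIn hX) (fun e heE hnear => ?_)
    (fun X hX htouch => ⟨markOf_eq_false_of_noCrossing hNC X hX htouch,
      markOf_eq_false_of_noCrossing hNC' X hX htouch⟩) hf hf01 hdep
  obtain ⟨y, hy, hnear'⟩ := hnear
  obtain ⟨e₀, he₀, rfl⟩ := Finset.mem_image.1 hy
  have hcd : cdist (cell e₀) (cell e) ≤ 1 := by
    have h := hgeo 0 e e₀ (fun i => by simpa using hnear' i)
    simpa using h
  refine hag (Sum.inl e) rfl (fun hsub => heE ?_) ⟨cell e₀, mem_linksIn.1 he₀, by simpa using hcd⟩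
  rw [mem_linksIn]
  simpa using hsub

/-! ### The good-exterior finite-size condition -/

omit [TopologicalSpace G] [IsTopologicalGroup G] [CompactSpace G] [BorelSpace G]
  [SecondCountableTopology G] W ρ in
/-- Two-sided comparison within the factor `F ≥ 1` of two numbers in `[0,1]` forces them within
`F - 1`. [folklore] -/
theorem abs_sub_le_of_two_sided {X Y F : ℝ} (hF : 1 ≤ F) (hX1 : X ≤ 1) (hY1 : Y ≤ 1)
    (h1 : X ≤ F * Y) (h2 : Y ≤ F * X) : |X - Y| ≤ F - 1 := by
  refine (abs_sub_le_sub_one_mul_of_le_mul hF h1 h2).trans ?_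
  calc (F - 1) * max X Y ≤ (F - 1) * 1 := mul_le_mul_of_nonneg_left (max_le hX1 hY1) (by linarith)
    _ = F - 1 := mul_one _

include hρ in
/-- A dressed kernel and Wilson's kernel give `[0,1]`-valued observables expectations within
`e^{ε₁ · cellCount} - 1` on a cell-union (local absolute continuity, `isLocallyAC_kernel_of_card_le`).
[folklore] -/
theorem abs_integral_dressed_sub_wilson_le [MeasurableSingletonClass G] (β : ℝ)
    (cell : Edge d N → CoarseIdx μc) {K : ℝ}
    (hK : ∀ A : Finset (Edge d N), ((A.image fun e => blockCorner b e.1).card : ℝ) ≤ K * cellCount cell A)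
    {κ η ε₁ : ℝ} (hκ : 0 ≤ κ) (hη : 0 ≤ η) (hW : W.NormLE κ η) (hε₁ : 2 * η * K ≤ ε₁) (hε₁0 : 0 ≤ ε₁)
    (hγ0 : IsSpecification ((0 : QuasiLocalGaugePerturbation d N G 1).kernel ρ β))
    (ΛP : Finset (FarPoly b d N)) (ΛE : Finset (Edge d N))
    (hunion : ∀ v w : Edge d N, cell v = cell w → v ∈ ΛE → w ∈ ΛE) {M : ℝ}
    (hcc : (cellCount cell ΛE : ℝ) ≤ M) (U : GaugeConfig d N G) {F : GaugeConfig d N G → ℝ}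
    (hFm : Measurable F) (hF01 : ∀ V, 0 ≤ F V ∧ F V ≤ 1) :
    |∫ V, F V ∂((W.dressed ΛP).kernel ρ β ΛE U) -
        ∫ V, F V ∂((0 : QuasiLocalGaugePerturbation d N G 1).kernel ρ β ΛE U)| ≤
      Real.exp (ε₁ * M) - 1 := by
  have hAC := isLocallyAC_kernel_of_card_le ρ hρ cell hK β hκ hη hε₁ (W.dressed ΛP) (hW.dressed ΛP)
  have hγd : IsSpecification ((W.dressed ΛP).kernel ρ β) :=
    (isSpecification_and_isGibbsMeasure_perturbedMeasure ρ hρ β (W.dressed ΛP)).1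
  haveI := hγd.isProbability ΛE U
  haveI := hγ0.isProbability ΛE U
  obtain ⟨h1, h2⟩ := hAC ΛE hunion U F hFm hF01
  have hexp_le : Real.exp (ε₁ * cellCount cell ΛE) ≤ Real.exp (ε₁ * M) :=
    Real.exp_le_exp.2 (mul_le_mul_of_nonneg_left hcc hε₁0)
  have hI0 : 0 ≤ ∫ V, F V ∂((W.dressed ΛP).kernel ρ β ΛE U) := integral_nonneg fun V => (hF01 V).1
  have hI0' : 0 ≤ ∫ V, F V ∂((0 : QuasiLocalGaugePerturbation d N G 1).kernel ρ β ΛE U) :=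
    integral_nonneg fun V => (hF01 V).1
  have hM : 0 ≤ ε₁ * M := le_trans (by positivity) (mul_le_mul_of_nonneg_left hcc hε₁0)
  exact abs_sub_le_of_two_sided (Real.one_le_exp hM)
    (integral_le_one_of_forall_le_one _ hF01) (integral_le_one_of_forall_le_one _ hF01)
    (h1.trans (mul_le_mul_of_nonneg_right hexp_le hI0'))
    (h2.trans (mul_le_mul_of_nonneg_right hexp_le hI0))

include hρ in
/-- Under the joint kernel of a volume, an observable of sites OUTSIDE the volume is frozen at the
exterior (properness). [folklore] -/
theorem integral_jointSpec_eq_self_of_dependsOn [MeasurableSingletonClass G] (β : ℝ)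
    (Λ : Finset (JSite b d N)) {f : (JSite b d N → G × Bool) → ℝ}
    (hout : DependsOn f ((↑Λ : Set (JSite b d N))ᶜ)) (ξ : JSite b d N → G × Bool) :
    ∫ σ, f σ ∂(W.jointSpec ρ β Λ ξ) = f ξ := by
  have hγ := W.isSpecification_jointSpec ρ hρ (b := b) β
  haveI := hγ.isProbability Λ ξ
  have h := kernel_integral_mul_of_dependsOn hγ Λ (f := fun _ => (1 : ℝ)) hout ξ
  simp only [one_mul, integral_const, smul_eq_mul, mul_one, probReal_univ] at h
  exact h

include hρ in
/-- **The good-exterior finite-size condition of the joint system** at window `n` and threshold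
`ε + 2(e^{ε₁ (4n+1)^d} − 1)` (`ε₁ ≥ 2ηK`), from `IsGoodFS (n, ε)` and the kernel-uniform Peierls
bound (at a level `< 1`, only to make empty cells good) of WILSON's kernels: inside the cube, the
`U`-marginal of the joint kernel is a dressed kernel, within the factor `e^{±ε₁ (4n+1)^d}` of
Wilson's. [folklore] -/
theorem isGoodFSHyper_jointSpec [MeasurableSingletonClass G] (β : ℝ)
    (cell : Edge d N → CoarseIdx μc) {K : ℝ}
    (hK : ∀ A : Finset (Edge d N), ((A.image fun e => blockCorner b e.1).card : ℝ) ≤ K * cellCount cell A)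
    {good : CoarseIdx μc → Set (GaugeConfig d N G)} {n : ℕ} {ε p κ η ε₁ : ℝ}
    (hγ0 : IsSpecification ((0 : QuasiLocalGaugePerturbation d N G 1).kernel ρ β))
    (hFS : IsGoodFS cell ((0 : QuasiLocalGaugePerturbation d N G 1).kernel ρ β) good n ε)
    (hp1 : p < 1) (hUKP : UniformKernelPeierls cell ((0 : QuasiLocalGaugePerturbation d N G 1).kernel ρ β) good p)
    (hκ : 0 ≤ κ) (hη : 0 ≤ η) (hW : W.NormLE κ η) (hε₁ : 2 * η * K ≤ ε₁) (hε₁0 : 0 ≤ ε₁)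
    (hε : 0 ≤ ε) :
    IsGoodFSHyper (jcell cell) (jterr (b := b) cell) jact (W.jointSpec ρ β) (jgood good) n
      (ε + 2 * (Real.exp (ε₁ * (4 * n + 1) ^ d) - 1)) := by
  classical
  refine ⟨fun c σ τ hστ => ?_, fun c => measurable_uOf (hFS.good_meas c), ?_⟩
  · -- goodness is cell-local in the link sites
    simp only [jgood, Set.mem_preimage]
    refine hFS.good_local c (uOf σ) (uOf τ) fun e he => ?_
    simp only [uOf]
    rw [hστ (Sum.inl e) rfl (by simpa using he)]
  intro c A hA ζ ζ' hag hgood hNC hNC' f hf hf01 hfdep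
  have hδ0 : 0 ≤ Real.exp (ε₁ * (4 * n + 1) ^ d) - 1 := by
    have : (1 : ℝ) ≤ Real.exp (ε₁ * (4 * n + 1) ^ d) := Real.one_le_exp (by positivity)
    linarith
  -- the observable reads the link sites homed at `c`
  have hfdep' : DependsOn f ((fun e => (Sum.inl e : JSite b d N)) '' {e | cell e = c}) := by
    refine fun σ τ hστ => hfdep fun v hv => ?_
    obtain ⟨e, rfl⟩ := (jact_eq_empty_iff v).1 hv.1
    exact hστ (Sum.inl e) ⟨e, hv.2, rfl⟩
  by_cases hcA : c ∈ A
  swap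
  · -- `c ∉ A`: the observable is frozen, and the two exteriors agree on it
    have hout : DependsOn f ((↑(hvol (jterr (b := b) cell) A) : Set (JSite b d N))ᶜ) := by
      refine hfdep'.mono ?_
      rintro _ ⟨e, he, rfl⟩ hmem
      have h := mem_hvol.1 (Finset.mem_coe.1 hmem)
      simp only [jterr_inl, Finset.singleton_subset_iff] at h
      exact hcA ((show cell e = c from he) ▸ h)
    rw [W.integral_jointSpec_eq_self_of_dependsOn ρ hρ β _ hout ζ,
      W.integral_jointSpec_eq_self_of_dependsOn ρ hρ β _ hout ζ',
      show f ζ = f ζ' from hfdep' fun v hv => ?_, sub_self, abs_zero]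
    · positivity
    · obtain ⟨e, he, rfl⟩ := hv
      exact hag (Sum.inl e) rfl (by simp [show cell e = c from he, cdist_self])
  -- `c ∈ A`: reduce to the dressed kernel of the link field
  have hvol' := hvol_jterr (b := b) cell A
  have hFm : Measurable fun U : GaugeConfig d N G => f (liftF U) := hf.comp measurable_liftF
  have hF01 : ∀ U : GaugeConfig d N G, 0 ≤ f (liftF U) ∧ f (liftF U) ≤ 1 := fun U => hf01 _
  have hFdep : DependsOn (fun U : GaugeConfig d N G => f (liftF U)) {e | cell e = c} := by
    refine fun U U' hUU' => hfdep fun v hv => ?_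
    obtain ⟨e, rfl⟩ := (jact_eq_empty_iff v).1 hv.1
    have hce : cell e = c := hv.2
    simp only [liftF, Sum.elim_inl]
    rw [hUU' e hce]
  -- junk removal and the marginal identification, for both exteriors
  have hred : ∀ ξ : JSite b d N → G × Bool, NoCrossing (jterr cell) jact A ξ →
      ∫ σ, f σ ∂(W.jointSpec ρ β (hvol (jterr cell) A) ξ) =
        ∫ U, f (liftF U) ∂((W.dressed (marksIn cell A)).kernel ρ β (linksIn cell A) (uOf ξ)) := by
    intro ξ hξ
    rw [hvol']
    rw [W.integral_jointSpec_eq_integral_comp_uOf ρ hρ β _ ξ hf (T := {e | cell e = c})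
      (fun e he => Finset.mem_union_left _ (Finset.mem_map_of_mem _ (mem_linksIn.2 (by
        rw [show cell e = c from he]; exact hcA)))) hfdep']
    exact W.integral_comp_uOf_jointSpec ρ hρ β (linksIn cell A) (marksIn cell A) ξ
      (fun X hX htouch => markOf_eq_false_of_noCrossing hξ X hX htouch) hFm hF01
  rw [hred ζ hNC, hred ζ' hNC']
  have hunion : ∀ v w : Edge d N, cell v = cell w → v ∈ linksIn cell A → w ∈ linksIn cell A :=
    linksIn_cellUnion cell A
  have hcc : (cellCount cell (linksIn cell A) : ℝ) ≤ (4 * n + 1) ^ d := by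
    have h := cellCount_le_pow_of_cdist_le cell c (2 * n) (linksIn cell A)
      fun e he => hA _ (mem_linksIn.1 he)
    have h' : (2 * (2 * n) + 1) = 4 * n + 1 := by ring
    rw [h'] at h
    exact_mod_cast h
  have hcmp := fun U => W.abs_integral_dressed_sub_wilson_le ρ hρ β cell hK hκ hη hW hε₁ hε₁0 hγ0
    (marksIn cell A) (linksIn cell A) hunion hcc U hFm hF01
  -- Wilson's good-exterior condition for the pair of link exteriors
  have hmid : |∫ V, f (liftF V) ∂((0 : QuasiLocalGaugePerturbation d N G 1).kernel ρ β (linksIn cell A) (uOf ζ)) -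
      ∫ V, f (liftF V) ∂((0 : QuasiLocalGaugePerturbation d N G 1).kernel ρ β (linksIn cell A) (uOf ζ'))| ≤ ε := by
    refine hFS.fs c (linksIn cell A) (fun e he => hA _ (mem_linksIn.1 he)) hunion (uOf ζ) (uOf ζ')
      (fun e he => ?_) (fun c' hc' hout => ?_) _ hFm hF01 hFdep
    · simp only [uOf]; rw [hag (Sum.inl e) rfl (by simpa using he)]
    · by_cases hne : ∃ e : Edge d N, cell e = c'
      · obtain ⟨e, he⟩ := hne
        have hc'A : c' ∉ A := fun h => hout e he (mem_linksIn.2 (he ▸ h))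
        have := hgood c' hc' hc'A
        simpa [jgood] using this
      · push Not at hne
        exact ⟨mem_good_of_cell_empty hγ0 hFS.good_local hp1 hUKP c' hne _,
          mem_good_of_cell_empty hγ0 hFS.good_local hp1 hUKP c' hne _⟩
  have h1 := hcmp (uOf ζ)
  have h3 := hcmp (uOf ζ')
  rw [abs_sub_comm] at h3
  have key := (abs_sub_le _ _ _).trans (add_le_add h1 ((abs_sub_le _ _ _).trans (add_le_add hmid h3)))
  linarith [key]

/-! ### The two-species Peierls bound -/

include hρ in
/-- **The two-species kernel-uniform Peierls bound of the joint system** at levels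
`(e^{3^d ε₁} p, r)`, `ε₁ ≥ 2ηK`: bad cells are priced by the kernel-uniform Peierls bound of
Wilson's kernels transferred to the dressed kernels (`kernel_allBad_le_of_uniformKernelPeierls`,
local absolute continuity), active marks by `jointSpec_preimage_uOf_inter_allActive_le`.
[folklore] -/
theorem hyperPeierls_jointSpec [MeasurableSingletonClass G] (β : ℝ)
    (cell : Edge d N → CoarseIdx μc) {K : ℝ}
    (hK : ∀ A : Finset (Edge d N), ((A.image fun e => blockCorner b e.1).card : ℝ) ≤ K * cellCount cell A)
    {good : CoarseIdx μc → Set (GaugeConfig d N G)} {p κ η ε₁ q : ℝ}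
    (hgl : ∀ (c : CoarseIdx μc) (σ τ : GaugeConfig d N G), (∀ v, cell v = c → σ v = τ v) →
      (σ ∈ good c ↔ τ ∈ good c)) (hgm : ∀ c, MeasurableSet (good c))
    (hp : 0 ≤ p) (hUKP : UniformKernelPeierls cell ((0 : QuasiLocalGaugePerturbation d N G 1).kernel ρ β) good p)
    (hκ : 0 ≤ κ) (hη : 0 ≤ η) (hW : W.NormLE κ η) (hε₁ : 2 * η * K ≤ ε₁) (hε₁0 : 0 ≤ ε₁)
    (hq : Real.exp (ε₁ * 3 ^ d) * p ≤ q) :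
    HyperPeierls (jterr (b := b) cell) jact (W.jointSpec ρ β) (jgood good) q W.jrar := by
  classical
  have hq0 : 0 ≤ q := le_trans (by positivity) hq
  intro A ζ hNC D M hD hM
  have hr0 : ∀ v, 0 ≤ W.jrar v := fun v => by
    rcases v with e | X
    · simp
    · simpa using W.rAct_nonneg X.1
  by_cases hlink : ∃ e : Edge d N, Sum.inl e ∈ M
  · -- a link site is never active: the event is empty
    obtain ⟨e, he⟩ := hlink
    have hempty : ({σ : JSite b d N → G × Bool | ∀ c ∈ D, σ ∉ jgood good c} ∩
        {σ | ∀ v ∈ M, σ v ∈ jact v}) = ∅ := by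
      ext σ
      simp only [Set.mem_inter_iff, Set.mem_setOf_eq, Set.mem_empty_iff_false, iff_false, not_and]
      intro _ hall
      simpa using hall _ he
    rw [hempty, measure_empty]
    exact zero_le
  · push Not at hlink
    -- every site of `M` is a mark site
    set M₀ : Finset (FarPoly b d N) := Finset.univ.filter fun X => Sum.inr X ∈ M with hM₀
    have hMeq : M = M₀.map (marksEmb b d N) := by
      ext v
      rcases v with e | X
      · simp only [Finset.mem_map, marksEmb_apply, reduceCtorEq, and_false, exists_false, iff_false]
        exact hlink e
      · simp [hM₀]
    rw [hvol_jterr] at hM ⊢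
    have hevent : ({σ : JSite b d N → G × Bool | ∀ c ∈ D, σ ∉ jgood good c} ∩
        {σ | ∀ v ∈ M, σ v ∈ jact v}) =
        (uOf ⁻¹' {U : GaugeConfig d N G | ∀ c ∈ D, U ∉ good c}) ∩ {σ | ∀ X ∈ M₀, markOf σ X = true} := by
      ext σ
      simp only [Set.mem_inter_iff, Set.mem_setOf_eq, Set.mem_preimage, jgood]
      refine and_congr Iff.rfl ⟨fun h X hX => ?_, fun h v hv => ?_⟩
      · have := h (Sum.inr X) (by simpa [hM₀] using hX)
        simpa [markOf] using this
      · rw [hMeq] at hv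
        obtain ⟨X, hX, rfl⟩ := Finset.mem_map.1 hv
        simpa [markOf] using h X hX
    rw [hevent]
    have hBm : MeasurableSet {U : GaugeConfig d N G | ∀ c ∈ D, U ∉ good c} :=
      Literature.Probability.LatticeModels.measurableSet_allBad hgm D
    have hsub : M₀.map (marksEmb b d N) ⊆ (linksIn cell A).map (linksEmb b d N) ∪
        (marksIn cell A).map (marksEmb b d N) := hMeq ▸ hM
    refine (W.jointSpec_preimage_uOf_inter_allActive_le ρ hρ β _ M₀ hsub ζ hBm).trans ?_
    -- the bad cells under the dressed kernel of the link field
    have hmap := W.map_uOf_jointSpec ρ hρ β (linksIn cell A) (marksIn cell A) ζ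
      (fun X hX htouch => markOf_eq_false_of_noCrossing hNC X hX htouch)
    have hbad : W.jointSpec ρ β ((linksIn cell A).map (linksEmb b d N) ∪
        (marksIn cell A).map (marksEmb b d N)) ζ (uOf ⁻¹' {U | ∀ c ∈ D, U ∉ good c}) ≤
        ENNReal.ofReal ((Real.exp (ε₁ * 3 ^ d) * p) ^ D.card) := by
      rw [← Measure.map_apply measurable_uOf hBm, hmap]
      have hγd : IsSpecification ((W.dressed (marksIn cell A)).kernel ρ β) :=
        (isSpecification_and_isGibbsMeasure_perturbedMeasure ρ hρ β (W.dressed (marksIn cell A))).1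
      have hAC := isLocallyAC_kernel_of_card_le ρ hρ cell hK β hκ hη hε₁ (W.dressed (marksIn cell A))
        (hW.dressed _)
      refine kernel_allBad_le_of_uniformKernelPeierls hγd hgl hgm hp hε₁0 hUKP hAC (linksIn cell A)
        (linksIn_cellUnion cell A) (uOf ζ) D fun c hc c' hcc' => ?_
      rcases hD c hc c' hcc' with h | h
      · exact Or.inl fun v hv => mem_linksIn.2 (hv ▸ h)
      · exact Or.inr (by simpa [jgood] using h)
    have hprod0 : 0 ≤ ∏ X ∈ M₀, W.rAct X.1 := Finset.prod_nonneg fun X _ => W.rAct_nonneg X.1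
    calc ENNReal.ofReal (∏ X ∈ M₀, W.rAct X.1) *
          W.jointSpec ρ β ((linksIn cell A).map (linksEmb b d N) ∪
            (marksIn cell A).map (marksEmb b d N)) ζ (uOf ⁻¹' {U | ∀ c ∈ D, U ∉ good c})
        ≤ ENNReal.ofReal (∏ X ∈ M₀, W.rAct X.1) *
            ENNReal.ofReal ((Real.exp (ε₁ * 3 ^ d) * p) ^ D.card) := by gcongr
      _ = ENNReal.ofReal ((∏ X ∈ M₀, W.rAct X.1) * (Real.exp (ε₁ * 3 ^ d) * p) ^ D.card) := by
          rw [ENNReal.ofReal_mul hprod0]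
      _ ≤ ENNReal.ofReal (q ^ D.card * ∏ v ∈ M, W.jrar v) := by
          refine ENNReal.ofReal_le_ofReal ?_
          rw [hMeq, Finset.prod_map, mul_comm]
          simp only [marksEmb_apply, jrar_inr]
          exact mul_le_mul_of_nonneg_right (pow_le_pow_left₀ (by positivity) hq _) hprod0

/-! ### Unconditional rarity of active marks -/

include hρ in
/-- **Active marks are rare under every joint kernel**: for every volume `Λ`, exterior `ζ` and
`M ⊆ Λ`, `γ_Λ({all sites of M active} | ζ) ≤ ∏_{v ∈ M} r_v` (F2; a link site is never active).
[folklore] -/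
theorem markRarity_jointSpec [MeasurableSingletonClass G] (β : ℝ) :
    MarkRarity jact (W.jointSpec ρ β) (W.jrar (b := b)) := by
  classical
  intro Λ ζ M hM
  by_cases hlink : ∃ e : Edge d N, Sum.inl e ∈ M
  · obtain ⟨e, he⟩ := hlink
    have hempty : ({σ : JSite b d N → G × Bool | ∀ v ∈ M, σ v ∈ jact v}) = ∅ := by
      ext σ
      simp only [Set.mem_setOf_eq, Set.mem_empty_iff_false, iff_false]
      intro hall
      simpa using hall _ he
    rw [hempty, measure_empty]
    exact zero_le
  · push Not at hlink
    set M₀ : Finset (FarPoly b d N) := Finset.univ.filter fun X => Sum.inr X ∈ M with hM₀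
    have hMeq : M = M₀.map (marksEmb b d N) := by
      ext v
      rcases v with e | X
      · simp only [Finset.mem_map, marksEmb_apply, reduceCtorEq, and_false, exists_false, iff_false]
        exact hlink e
      · simp [hM₀]
    have hevent : ({σ : JSite b d N → G × Bool | ∀ v ∈ M, σ v ∈ jact v}) =
        (uOf ⁻¹' (Set.univ : Set (GaugeConfig d N G))) ∩ {σ | ∀ X ∈ M₀, markOf σ X = true} := by
      ext σ
      simp only [Set.mem_setOf_eq, Set.preimage_univ, Set.univ_inter]
      refine ⟨fun h X hX => ?_, fun h v hv => ?_⟩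
      · have := h (Sum.inr X) (by simpa [hM₀] using hX)
        simpa [markOf] using this
      · rw [hMeq] at hv
        obtain ⟨X, hX, rfl⟩ := Finset.mem_map.1 hv
        simpa [markOf] using h X hX
    rw [hevent]
    haveI := (W.isSpecification_jointSpec ρ hρ (b := b) β).isProbability Λ ζ
    refine (W.jointSpec_preimage_uOf_inter_allActive_le ρ hρ β Λ M₀ (hMeq ▸ hM) ζ
      MeasurableSet.univ).trans ?_
    calc ENNReal.ofReal (∏ X ∈ M₀, W.rAct X.1) * W.jointSpec ρ β Λ ζ (uOf ⁻¹' Set.univ)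
        ≤ ENNReal.ofReal (∏ X ∈ M₀, W.rAct X.1) * 1 := by gcongr; exact prob_le_one
      _ = ENNReal.ofReal (∏ v ∈ M, W.jrar v) := by
          rw [mul_one, hMeq, Finset.prod_map]
          simp only [marksEmb_apply, jrar_inr]

/-! ### Kotecký–Preiss smallness of the second species -/

omit [TopologicalSpace G] [IsTopologicalGroup G] [CompactSpace G] [BorelSpace G]
  [SecondCountableTopology G] [Group G] [MeasurableSpace G] W ρ in
/-- The image of a link set under the cell map has `cellCount` elements. [folklore] -/
theorem card_image_eq_cellCount (cell : Edge d N → CoarseIdx μc) (A : Finset (Edge d N)) :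
    (A.image cell).card = cellCount cell A := by
  classical
  unfold cellCount
  congr 1
  ext c
  simp [Finset.mem_image]

omit [TopologicalSpace G] [IsTopologicalGroup G] [CompactSpace G] [BorelSpace G]
  [SecondCountableTopology G] [Group G] [MeasurableSpace G] W ρ in
/-- **Territories are at most `3^d` cells per block**: if cells contract block nearness, the links
of the blocks of `X` lie in at most `3^d |X|` cells. [folklore] -/
theorem card_image_cell_polymerEdges_le (cell : Edge d N → CoarseIdx μc)
    (hgeo : ∀ (D : ℕ) (e e' : Edge d N),
      (∀ i, (blockCorner b e'.1 i - blockCorner b e.1 i).val ≤ b * (2 * D + 1) ∨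
        (blockCorner b e.1 i - blockCorner b e'.1 i).val ≤ b * (2 * D + 1)) →
      cdist (cell e') (cell e) ≤ D + 1)
    (X : Finset (Site d N)) : ((polymerEdges b X).image cell).card ≤ 3 ^ d * X.card := by
  classical
  have hbi : polymerEdges b X = X.biUnion fun y => Finset.univ.filter fun e : Edge d N =>
      blockCorner b e.1 = y := by
    ext e
    simp [mem_polymerEdges_iff]
  rw [hbi, Finset.biUnion_image]
  refine (Finset.card_biUnion_le).trans ?_
  rw [mul_comm]
  refine Finset.sum_le_card_nsmul _ _ _ fun y _ => ?_
  set Ay : Finset (Edge d N) := Finset.univ.filter fun e : Edge d N => blockCorner b e.1 = y with hAy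
  rcases Ay.eq_empty_or_nonempty with h0 | ⟨e₀, he₀⟩
  · rw [h0]; simp
  · rw [card_image_eq_cellCount]
    have h := cellCount_le_pow_of_cdist_le cell (cell e₀) 1 Ay fun e he => ?_
    · simpa using h
    · have hy0 : blockCorner b e₀.1 = y := (Finset.mem_filter.1 he₀).2
      have hy : blockCorner b e.1 = y := (Finset.mem_filter.1 he).2
      have := hgeo 0 e e₀ fun i => by simp [hy0, hy]
      simpa using this

omit [TopologicalSpace G] [IsTopologicalGroup G] [CompactSpace G] [BorelSpace G]
  [SecondCountableTopology G] ρ in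
/-- **Kotecký–Preiss smallness of the active-mark species**: for every cell `c`,
`∑_{X : c ∈ T(X)} r_X e^{λ |T(X)|} ≤ 2(1+e²) K η` as soon as `‖W‖_{b,κ} ≤ η ≤ 1` with
`κ ≥ 3^d λ` (each block meets at most `K`… rather each cell meets at most `K` blocks; the weight
`e^{κ|X|}` of the norm absorbs `e^{λ|T(X)|}`, `|T(X)| ≤ 3^d |X|`; link sites contribute `0`).
[folklore] -/
theorem kp_sum_jrar_le (cell : Edge d N → CoarseIdx μc) {K : ℝ} (hK0 : 0 ≤ K)
    (hK : ∀ A : Finset (Edge d N), ((A.image fun e => blockCorner b e.1).card : ℝ) ≤ K * cellCount cell A)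
    (hgeo : ∀ (D : ℕ) (e e' : Edge d N),
      (∀ i, (blockCorner b e'.1 i - blockCorner b e.1 i).val ≤ b * (2 * D + 1) ∨
        (blockCorner b e.1 i - blockCorner b e'.1 i).val ≤ b * (2 * D + 1)) →
      cdist (cell e') (cell e) ≤ D + 1)
    {κ η lam : ℝ} (hlam : 0 ≤ lam) (hκ : (3 : ℝ) ^ d * lam ≤ κ) (hη : 0 ≤ η) (hη1 : η ≤ 1)
    (hW : W.NormLE κ η) (c : CoarseIdx μc) :
    ∑ v ∈ Finset.univ.filter (fun v : JSite b d N => c ∈ jterr cell v),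
        W.jrar v * Real.exp (lam * (jterr cell v).card) ≤ 2 * (1 + Real.exp 2) * K * η := by
  classical
  have hκ0 : 0 ≤ κ := le_trans (by positivity) hκ
  set Cst : ℝ := 2 * (1 + Real.exp 2) with hCst
  have hCst0 : 0 ≤ Cst := by positivity
  set g : Finset (Site d N) → ℝ := fun Y => W.supNorm Y * Real.exp (κ * Y.card) with hg
  have hg0 : ∀ Y, 0 ≤ g Y := fun Y => mul_nonneg (W.supNorm_nonneg Y) (Real.exp_pos _).le
  set P : Finset (Site d N) → Prop := fun Y => c ∈ (polymerEdges b Y).image cell with hP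
  -- sup norms of far polymers are at most `η ≤ 1`
  have hsY : ∀ Y ∈ polymers (d := d) (L := N) b, Y.Nonempty → W.supNorm Y ≤ η := by
    intro Y hY hne
    obtain ⟨y, hy⟩ := hne
    have h := supNorm_mul_exp_le_of_normLE hW hY hy
    have h1 : 1 ≤ Real.exp (κ * Y.card) := Real.one_le_exp (by positivity)
    nlinarith [W.supNorm_nonneg Y]
  -- from the site sum to the far polymers
  rw [Finset.sum_filter, Fintype.sum_sum_type]
  simp only [jterr_inl, jrar_inl, zero_mul, ite_self, Finset.sum_const_zero, zero_add,
    jterr_inr, jrar_inr]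
  -- termwise bound on the far polymers
  have hterm : ∀ X : FarPoly b d N,
      (if c ∈ (polymerEdges b X.1).image cell then
          W.rAct X.1 * Real.exp (lam * ((polymerEdges b X.1).image cell).card) else 0) ≤
        Cst * (if P X.1 then g X.1 else 0) := by
    intro X
    by_cases hPX : c ∈ (polymerEdges b X.1).image cell
    · rw [if_pos hPX, if_pos hPX]
      obtain ⟨hXp, hX2⟩ := mem_farPolymers_iff.1 X.2
      have hne : X.1.Nonempty := Finset.card_pos.1 (by omega)
      have hs := hsY X.1 hXp hne
      have hs0 := W.supNorm_nonneg X.1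
      have hr : W.rAct X.1 ≤ Cst * W.supNorm X.1 := by
        refine (W.rAct_le X.1).trans ?_
        have he : Real.exp (2 * W.supNorm X.1) ≤ Real.exp 2 := Real.exp_le_exp.2 (by nlinarith)
        rw [hCst]
        nlinarith [Real.exp_pos (2 * W.supNorm X.1)]
      have hcard : (((polymerEdges b X.1).image cell).card : ℝ) ≤ 3 ^ d * X.1.card := by
        exact_mod_cast card_image_cell_polymerEdges_le cell hgeo X.1
      have hexp : Real.exp (lam * ((polymerEdges b X.1).image cell).card) ≤
          Real.exp (κ * X.1.card) := by
        refine Real.exp_le_exp.2 ?_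
        calc lam * ((polymerEdges b X.1).image cell).card ≤ lam * (3 ^ d * X.1.card) :=
              mul_le_mul_of_nonneg_left hcard hlam
          _ = (3 ^ d * lam) * X.1.card := by ring
          _ ≤ κ * X.1.card := mul_le_mul_of_nonneg_right hκ (Nat.cast_nonneg _)
      calc W.rAct X.1 * Real.exp (lam * ((polymerEdges b X.1).image cell).card)
          ≤ (Cst * W.supNorm X.1) * Real.exp (κ * X.1.card) :=
            mul_le_mul hr hexp (Real.exp_pos _).le (by positivity)
        _ = Cst * g X.1 := by rw [hg]; ring
    · rw [if_neg hPX, if_neg hPX, mul_zero]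
  refine (Finset.sum_le_sum fun X _ => hterm X).trans ?_
  rw [← Finset.mul_sum]
  -- the far-polymer sum through the blocks meeting the cell `c`
  set Bc : Finset (Site d N) := (Finset.univ.filter fun e : Edge d N => cell e = c).image
    fun e => blockCorner b e.1 with hBc
  have hBcK : (Bc.card : ℝ) ≤ K := by
    refine (hK _).trans ?_
    have hcc : cellCount cell (Finset.univ.filter fun e : Edge d N => cell e = c) ≤ 1 := by
      rw [← card_image_eq_cellCount]
      refine Finset.card_le_one.2 fun x hx y hy => ?_
      obtain ⟨e, he, rfl⟩ := Finset.mem_image.1 hx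
      obtain ⟨e', he', rfl⟩ := Finset.mem_image.1 hy
      rw [(Finset.mem_filter.1 he).2, (Finset.mem_filter.1 he').2]
    calc K * (cellCount cell (Finset.univ.filter fun e : Edge d N => cell e = c) : ℝ) ≤ K * 1 := by
          refine mul_le_mul_of_nonneg_left ?_ hK0; exact_mod_cast hcc
      _ = K := mul_one K
  have hsum : ∑ X : FarPoly b d N, (if P X.1 then g X.1 else 0) ≤ Bc.card * η := by
    calc ∑ X : FarPoly b d N, (if P X.1 then g X.1 else 0)
        = ∑ Y ∈ farPolymers (d := d) (N := N) b, (if P Y then g Y else 0) :=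
          Finset.sum_coe_sort _ (fun Y => if P Y then g Y else 0)
      _ ≤ ∑ Y ∈ polymers (d := d) (L := N) b, (if P Y then g Y else 0) :=
          Finset.sum_le_sum_of_subset_of_nonneg (Finset.filter_subset _ _)
            fun Y _ _ => by split_ifs; exacts [hg0 Y, le_rfl]
      _ = ∑ Y ∈ (polymers b).filter P, g Y := (Finset.sum_filter _ _).symm
      _ ≤ ∑ y ∈ Bc, ∑ Y ∈ (polymersThrough b y).filter P, g Y := by
          refine sum_filter_le_sum_sum_polymersThrough Bc P (fun Y _ hPY => ?_) hg0
          obtain ⟨e, he, hec⟩ := Finset.mem_image.1 hPY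
          exact ⟨blockCorner b e.1, Finset.mem_image.2 ⟨e, Finset.mem_filter.2 ⟨Finset.mem_univ _, hec⟩, rfl⟩,
            mem_polymerEdges_iff.1 he⟩
      _ ≤ ∑ y ∈ Bc, ∑ Y ∈ polymersThrough b y, g Y :=
          Finset.sum_le_sum fun y _ => Finset.sum_le_sum_of_subset_of_nonneg (Finset.filter_subset _ _)
            fun Y _ _ => hg0 Y
      _ ≤ ∑ y ∈ Bc, η := Finset.sum_le_sum fun y hy => ?_
      _ = Bc.card * η := by rw [Finset.sum_const, nsmul_eq_mul]
    · obtain ⟨e, -, rfl⟩ := Finset.mem_image.1 hy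
      exact hW _ (mem_blockCorners_iff.2 (isBlockAligned_blockCorner b e.1))
  calc Cst * ∑ X : FarPoly b d N, (if P X.1 then g X.1 else 0) ≤ Cst * (Bc.card * η) :=
        mul_le_mul_of_nonneg_left hsum hCst0
    _ ≤ Cst * (K * η) := mul_le_mul_of_nonneg_left (mul_le_mul_of_nonneg_right hBcK hη) hCst0
    _ = 2 * (1 + Real.exp 2) * K * η := by rw [hCst]; ring

/-! ### Covariances under the perturbed measure are covariances under the joint measure -/

include hρ in
/-- **Covariances under `μ_{β,W}` from covariance bounds for the joint system**: `μ_{β,W}` is the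
`U`-marginal of the joint Gibbs measure (`map_uOf_jointMeasure`), and an observable of the links of
the cells `Δ` is, composed with `uOf`, an observable of the ORDINARY sites of `Δ` of the joint
system. [folklore] -/
theorem abs_cov_le_of_joint_cov [MeasurableSingletonClass G] (β : ℝ)
    (cell : Edge d N → CoarseIdx μc) {B : Finset (CoarseIdx μc) → Finset (CoarseIdx μc) → ℕ → ℝ}
    (hjoint : ∀ (F H : (JSite b d N → G × Bool) → ℝ) (Δf Δg : Finset (CoarseIdx μc))
      (Bf Bg : ℝ) (D : ℕ), Measurable F → Measurable H → (∀ σ, |F σ| ≤ Bf) → (∀ σ, |H σ| ≤ Bg) →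
      DependsOn F {v | jact (G := G) v = ∅ ∧ jcell cell v ∈ Δf} →
      DependsOn H {v | jact (G := G) v = ∅ ∧ jcell cell v ∈ Δg} →
      (∀ x ∈ Δf, ∀ y ∈ Δg, D ≤ cdist x y) →
        |∫ σ, F σ * H σ ∂(W.jointMeasure ρ β) -
            (∫ σ, F σ ∂(W.jointMeasure ρ β)) * ∫ σ, H σ ∂(W.jointMeasure ρ β)| ≤
          Bf * Bg * B Δf Δg D)
    (f g : GaugeConfig d N G → ℝ) (Δf Δg : Finset (CoarseIdx μc)) (Bf Bg : ℝ) (D : ℕ)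
    (hf : Measurable f) (hg : Measurable g) (hfB : ∀ U, |f U| ≤ Bf) (hgB : ∀ U, |g U| ≤ Bg)
    (hfdep : DependsOn f {e | cell e ∈ Δf}) (hgdep : DependsOn g {e | cell e ∈ Δg})
    (hD : ∀ x ∈ Δf, ∀ y ∈ Δg, D ≤ cdist x y) :
    |∫ U, f U * g U ∂(W.perturbedMeasure ρ β) -
        (∫ U, f U ∂(W.perturbedMeasure ρ β)) * ∫ U, g U ∂(W.perturbedMeasure ρ β)| ≤
      Bf * Bg * B Δf Δg D := by
  rw [← W.map_uOf_jointMeasure ρ hρ β,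
    integral_map (f := fun U => f U * g U) measurable_uOf.aemeasurable
      (hf.mul hg).aestronglyMeasurable,
    integral_map (f := f) measurable_uOf.aemeasurable hf.aestronglyMeasurable,
    integral_map (f := g) measurable_uOf.aemeasurable hg.aestronglyMeasurable]
  have hdep : ∀ {h : GaugeConfig d N G → ℝ} {Δ : Finset (CoarseIdx μc)},
      DependsOn h {e | cell e ∈ Δ} →
      DependsOn (fun σ : JSite b d N → G × Bool => h (uOf σ))
        {v | jact (G := G) v = ∅ ∧ jcell cell v ∈ Δ} := by
    intro h Δ hh σ τ hστ
    refine hh fun e he => ?_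
    simp only [uOf]; rw [hστ (Sum.inl e) ⟨rfl, he⟩]
  exact hjoint (fun σ => f (uOf σ)) (fun σ => g (uOf σ)) Δf Δg Bf Bg D (hf.comp measurable_uOf)
    (hg.comp measurable_uOf) (fun σ => hfB _) (fun σ => hgB _) (hdep hfdep) (hdep hgdep) hD

/-! ### The reduction: a two-species engine gives clustering of the dressed measures -/

omit [TopologicalSpace G] [IsTopologicalGroup G] [CompactSpace G] [BorelSpace G]
  [SecondCountableTopology G] [Group G] [MeasurableSpace G] [NeZero N] W ρ in
/-- **Exponential clustering of dressed gauge measures from the two-species coarse-cell engine.**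
Suppose the two-species coarse-cell engine holds in dimension `d` (hypothesis `hHyper`, pure
coarse-cell probability in the vocabulary of `CoarseCellHyperDefects`: for every window `n` there
are `q₀, λ, κₑ, C` such that every specification with territories and activity events that is
hyper-Markov, satisfies the good-exterior finite-size condition `(n, ε)`, `ε · shellCount ≤ 3/4`,
the two-species Peierls bound at levels `(q ≤ q₀, r)`, the unconditional rarity of active marks
and the Kotecký–Preiss smallness `∑_{v ∋ c} r_v e^{λ|terr v|} ≤ q`, has, under each of its Gibbs
measures, covariances of bounded observables of the ordinary sites of `Δf`, `Δg` at coarse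
distance `≥ D` bounded by `C B_f B_g e^{|Δf|} |Δg| e^{-κₑ D}`). Then for every window `n ≥ 1` there are thresholds
`p₀, η₀, κ₀ > 0` such that every lattice gauge measure dressed by a quasi-local perturbation `W`
with `‖W‖_{b,κ} ≤ η`, `κ ≥ κ₀`, `ηK ≤ η₀`, read through cells (`≥ 4n+3` per axis, `≤ K` blocks per
cell, contracting block nearness) for which WILSON's kernels satisfy `IsGoodFS (n, ε)`,
`2ε·shellCount ≤ 1`, and the kernel-uniform Peierls bound at level `p ≤ p₀`, clusters
exponentially: `|cov(f,g)| ≤ C₀ B_f B_g e^{|Δf|} |Δg| e^{-κₑ D}` with `(κₑ, C₀)` depending on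
`(n, ε)` only — the statement `DressedGaugeEngine d` of the RobustYangMills crux line
(Summits), with the engine isolated. Proof: the joint `(U, mark)` system of the Bernoulli
decoupling of the far polymers (`isHyperMarkov_jointSpec`, `isGoodFSHyper_jointSpec`,
`hyperPeierls_jointSpec`, `markRarity_jointSpec`, `kp_sum_jrar_le`) and `abs_cov_le_of_joint_cov`.
[folklore] -/
theorem dressed_covariance_decay_of_hyperEngine
    (hHyper : ∀ n : ℕ, ∃ q₀ lam κₑ C : ℝ, 0 < q₀ ∧ 0 ≤ lam ∧ 0 < κₑ ∧ 0 ≤ C ∧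
      ∀ {μ : Fin d → ℕ} {V S : Type} [MeasurableSpace S] [Fintype V] [DecidableEq V]
        (cell : V → CoarseIdx μ) (terr : V → Finset (CoarseIdx μ)) (act : V → Set S)
        (γ : Specification V S) (good : CoarseIdx μ → Set (V → S)) (ν : Measure (V → S))
        (ε q : ℝ) (r : V → ℝ),
        (∀ i, 4 * n + 3 ≤ μ i + 1) → IsSpecification γ → IsGibbsMeasure γ ν →
        (∀ v, act v = ∅ → terr v = {cell v}) → (∀ v, MeasurableSet (act v)) →
        IsHyperMarkov cell terr act γ →
        0 ≤ ε → ε * (shellCount d n : ℝ) ≤ 3 / 4 → IsGoodFSHyper cell terr act γ good n ε →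
        0 ≤ q → q ≤ q₀ → (∀ v, 0 ≤ r v) → HyperPeierls terr act γ good q r → MarkRarity act γ r →
        (∀ c : CoarseIdx μ, ∑ v ∈ Finset.univ.filter (fun v => c ∈ terr v),
            r v * Real.exp (lam * (terr v).card) ≤ q) →
        ∀ (f g : (V → S) → ℝ) (Δf Δg : Finset (CoarseIdx μ)) (Bf Bg : ℝ) (D : ℕ),
          Measurable f → Measurable g → (∀ σ, |f σ| ≤ Bf) → (∀ σ, |g σ| ≤ Bg) →
          DependsOn f {v | act v = ∅ ∧ cell v ∈ Δf} → DependsOn g {v | act v = ∅ ∧ cell v ∈ Δg} →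
          (∀ x ∈ Δf, ∀ y ∈ Δg, D ≤ cdist x y) →
            |∫ σ, f σ * g σ ∂ν - (∫ σ, f σ ∂ν) * ∫ σ, g σ ∂ν| ≤
              C * Bf * Bg * Real.exp (Δf.card) * Δg.card * Real.exp (-(κₑ * D))) :
    ∀ n : ℕ, 1 ≤ n → ∃ p₀ η₀ κ₀ : ℝ, 0 < p₀ ∧ 0 < η₀ ∧ 0 < κ₀ ∧
    ∀ ε : ℝ, 0 ≤ ε → 2 * ε * (shellCount d n : ℝ) ≤ 1 →
    ∃ κₑ C₀ : ℝ, 0 < κₑ ∧ 0 ≤ C₀ ∧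
    ∀ (G : Type) [Group G] [TopologicalSpace G] [IsTopologicalGroup G] [CompactSpace G]
      [MeasurableSpace G] [BorelSpace G] [SecondCountableTopology G] [MeasurableSingletonClass G]
      (Nρ : ℕ) (ρ : G →* Matrix (Fin Nρ) (Fin Nρ) ℂ), Continuous ρ →
    ∀ (N : ℕ) [NeZero N] (b : ℕ) (μc : Fin d → ℕ) (cell : Edge d N → CoarseIdx μc) (K : ℝ)
      (good : CoarseIdx μc → Set (GaugeConfig d N G)) (β κ η p : ℝ)
      (W : QuasiLocalGaugePerturbation d N G b),
      1 ≤ b → (∀ i, 4 * n + 3 ≤ μc i + 1) → 0 ≤ K →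
      (∀ A : Finset (Edge d N),
        ((A.image fun e => blockCorner b e.1).card : ℝ) ≤ K * cellCount cell A) →
      (∀ (D : ℕ) (e e' : Edge d N),
        (∀ i, (blockCorner b e'.1 i - blockCorner b e.1 i).val ≤ b * (2 * D + 1) ∨
          (blockCorner b e.1 i - blockCorner b e'.1 i).val ≤ b * (2 * D + 1)) →
        cdist (cell e') (cell e) ≤ D + 1) →
      IsSpecification ((0 : QuasiLocalGaugePerturbation d N G 1).kernel ρ β) →
      IsSpecification (W.kernel ρ β) → IsGibbsMeasure (W.kernel ρ β) (W.perturbedMeasure ρ β) →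
      IsGoodFS cell ((0 : QuasiLocalGaugePerturbation d N G 1).kernel ρ β) good n ε →
      0 ≤ p → p ≤ p₀ →
      UniformKernelPeierls cell ((0 : QuasiLocalGaugePerturbation d N G 1).kernel ρ β) good p →
      κ₀ ≤ κ → W.NormLE κ η → η * K ≤ η₀ →
      (∀ X : Finset (Site d N), X ∈ polymers b → (∃ U : GaugeConfig d N G, W.act X U ≠ 0) →
        ∀ y ∈ X, ∀ y' ∈ X, ∀ i : Fin d,
          (y i - y' i).val ≤ b * X.card ∨ (y' i - y i).val ≤ b * X.card) →
      ∀ (f g : GaugeConfig d N G → ℝ) (Δf Δg : Finset (CoarseIdx μc)) (Bf Bg : ℝ) (D : ℕ),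
        Measurable f → Measurable g → (∀ U, |f U| ≤ Bf) → (∀ U, |g U| ≤ Bg) →
        DependsOn f {e | cell e ∈ Δf} → DependsOn g {e | cell e ∈ Δg} →
        (∀ x ∈ Δf, ∀ y ∈ Δg, D ≤ cdist x y) →
          |∫ U, f U * g U ∂(W.perturbedMeasure ρ β) -
              (∫ U, f U ∂(W.perturbedMeasure ρ β)) * ∫ U, g U ∂(W.perturbedMeasure ρ β)| ≤
            C₀ * Bf * Bg * Real.exp (Δf.card) * Δg.card * Real.exp (-(κₑ * D)) := by
  intro n hn
  obtain ⟨q₀, lam, κₑ, C, hq₀, hlam, hκₑ, hC, hyp⟩ := hHyper n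
  -- the thresholds
  set s : ℝ := (shellCount d n : ℝ) with hs
  have hs0 : 0 ≤ s := Nat.cast_nonneg _
  set A₁ : ℝ := (4 * (n : ℝ) + 1) ^ d with hA₁
  have hA₁pos : 0 < A₁ := by positivity
  set L : ℝ := Real.log (1 + 1 / (8 * (s + 1))) with hL
  have hLpos : 0 < L := Real.log_pos (by
    have : 0 < 1 / (8 * (s + 1)) := by positivity
    linarith)
  set η₀ : ℝ := min (min 1 (q₀ / (2 * (1 + Real.exp 2)))) (L / (2 * A₁)) with hη₀
  have hη₀pos : 0 < η₀ := by
    rw [hη₀]; refine lt_min (lt_min zero_lt_one (by positivity)) (by positivity)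
  have hη₀1 : η₀ ≤ 1 := (min_le_left _ _).trans (min_le_left _ _)
  have hη₀q : η₀ ≤ q₀ / (2 * (1 + Real.exp 2)) := (min_le_left _ _).trans (min_le_right _ _)
  have hη₀L : η₀ ≤ L / (2 * A₁) := min_le_right _ _
  set κ₀ : ℝ := 3 ^ d * lam + 1 with hκ₀
  have hκ₀pos : 0 < κ₀ := by positivity
  set p₀ : ℝ := min (1 / 2) (q₀ * Real.exp (-(2 * η₀ * 3 ^ d))) with hp₀
  have hp₀pos : 0 < p₀ := lt_min (by norm_num) (by positivity)
  refine ⟨p₀, η₀, κ₀, hp₀pos, hη₀pos, hκ₀pos, fun ε hε hεs => ⟨κₑ, C, hκₑ, hC, ?_⟩⟩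
  intro G _ _ _ _ _ _ _ _ Nρ ρ hρ N _ b μc cell K good β κ η p W hb hμ hK0 hK hgeo hγ0 _hγW
    _hGibbsW hFS hp hpp₀ hUKP hκ hW hηK _hRC f g Δf Δg Bf Bg D hf hg hfB hgB hfdep hgdep hD
  classical
  have hη : 0 ≤ η := hW.nonneg
  have hκ0 : 0 ≤ κ := le_trans hκ₀pos.le hκ
  have hκlam : (3 : ℝ) ^ d * lam ≤ κ := le_trans (by rw [hκ₀]; linarith) hκ
  have hp1 : p < 1 := lt_of_le_of_lt (hpp₀.trans (min_le_left _ _)) (by norm_num)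
  -- degenerate case: no links at all
  rcases isEmpty_or_nonempty (Edge d N) with hE | hE
  · have hfc : ∀ U U' : GaugeConfig d N G, f U = f U' := fun U U' =>
      hfdep fun e _ => (hE.false e).elim
    have h0 : ∫ U, f U * g U ∂(W.perturbedMeasure ρ β) -
        (∫ U, f U ∂(W.perturbedMeasure ρ β)) * ∫ U, g U ∂(W.perturbedMeasure ρ β) = 0 := by
      haveI := (isSpecification_and_isGibbsMeasure_perturbedMeasure ρ hρ β W).2.isProbabilityMeasure
      have hconst : f = fun _ => f 1 := funext fun U => hfc U 1
      rw [hconst]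
      simp [integral_const_mul]
    rw [h0, abs_zero]
    have hBf : 0 ≤ Bf := (abs_nonneg _).trans (hfB 1)
    have hBg : 0 ≤ Bg := (abs_nonneg _).trans (hgB 1)
    positivity
  -- `K ≥ 1`, hence `η ≤ η₀ ≤ 1`
  obtain ⟨e₀⟩ := hE
  have hK1 : 1 ≤ K := by
    have h := hK {e₀}
    rw [Finset.image_singleton, Finset.card_singleton, ← card_image_eq_cellCount,
      Finset.image_singleton, Finset.card_singleton] at h
    simpa using h
  have hηη₀ : η ≤ η₀ := le_trans (by nlinarith) hηK
  have hη1 : η ≤ 1 := hηη₀.trans hη₀1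
  -- the joint system and its constants
  set ε₁ : ℝ := 2 * η * K with hε₁
  have hε₁0 : 0 ≤ ε₁ := by positivity
  have hε₁le : ε₁ ≤ 2 * η₀ := by rw [hε₁]; nlinarith
  set ε' : ℝ := ε + 2 * (Real.exp (ε₁ * (4 * n + 1) ^ d) - 1) with hε'
  have hδ : Real.exp (ε₁ * (4 * n + 1) ^ d) - 1 ≤ 1 / (8 * (s + 1)) := by
    have h1 : ε₁ * (4 * (n : ℝ) + 1) ^ d ≤ L := by
      calc ε₁ * (4 * (n : ℝ) + 1) ^ d ≤ (2 * η₀) * A₁ := by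
            rw [hA₁]; exact mul_le_mul_of_nonneg_right hε₁le (by positivity)
        _ ≤ (2 * (L / (2 * A₁))) * A₁ :=
            mul_le_mul_of_nonneg_right (by linarith) hA₁pos.le
        _ = L := by field_simp
    have h2 : Real.exp (ε₁ * (4 * (n : ℝ) + 1) ^ d) ≤ 1 + 1 / (8 * (s + 1)) := by
      calc Real.exp (ε₁ * (4 * (n : ℝ) + 1) ^ d) ≤ Real.exp L := Real.exp_le_exp.2 h1
        _ = 1 + 1 / (8 * (s + 1)) := by rw [hL, Real.exp_log (by positivity)]
    have h3 : ((4 : ℝ) * n + 1) ^ d = (4 * (n : ℝ) + 1) ^ d := rfl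
    linarith
  have hε'0 : 0 ≤ ε' := by
    have : 0 ≤ Real.exp (ε₁ * (4 * n + 1) ^ d) - 1 := by
      have := Real.one_le_exp (show 0 ≤ ε₁ * (4 * (n : ℝ) + 1) ^ d by positivity); linarith
    rw [hε']; positivity
  have hε's : ε' * s ≤ 3 / 4 := by
    have h1 : ε * s ≤ 1 / 2 := by rw [hs]; linarith
    have h2 : (Real.exp (ε₁ * (4 * n + 1) ^ d) - 1) * s ≤ 1 / 8 := by
      calc (Real.exp (ε₁ * (4 * n + 1) ^ d) - 1) * s ≤ (1 / (8 * (s + 1))) * s :=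
            mul_le_mul_of_nonneg_right hδ hs0
        _ ≤ 1 / 8 := by
            rw [div_mul_eq_mul_div, div_le_iff₀ (by positivity)]; nlinarith
    rw [hε']; nlinarith
  have hq : Real.exp (ε₁ * 3 ^ d) * p ≤ q₀ := by
    have h1 : Real.exp (ε₁ * 3 ^ d) ≤ Real.exp (2 * η₀ * 3 ^ d) :=
      Real.exp_le_exp.2 (mul_le_mul_of_nonneg_right hε₁le (by positivity))
    have h2 : p ≤ q₀ * Real.exp (-(2 * η₀ * 3 ^ d)) := hpp₀.trans (min_le_right _ _)
    calc Real.exp (ε₁ * 3 ^ d) * p ≤ Real.exp (2 * η₀ * 3 ^ d) * (q₀ * Real.exp (-(2 * η₀ * 3 ^ d))) :=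
          mul_le_mul h1 h2 hp (Real.exp_pos _).le
      _ = q₀ := by rw [Real.exp_neg]; field_simp
  -- the hypotheses of the engine for the joint system
  have hγ := W.isSpecification_jointSpec ρ hρ (b := b) β
  have hν := W.isGibbsMeasure_jointMeasure ρ hρ (b := b) β
  haveI : Nonempty G := ⟨1⟩
  have hspin : ∀ v : JSite b d N, jact (G := G) v = ∅ → jterr (b := b) cell v = {jcell cell v} :=
    fun v hv => jterr_eq_singleton_of_jact_eq_empty cell v hv
  have hHM := W.isHyperMarkov_jointSpec ρ hρ hb β cell hgeo
  have hHF := W.isGoodFSHyper_jointSpec ρ hρ β cell hK hγ0 hFS hp1 hUKP hκ0 hη hW (le_refl ε₁) hε₁0 hε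
  have hHP := W.hyperPeierls_jointSpec ρ hρ β cell hK hFS.good_local hFS.good_meas hp hUKP hκ0 hη hW
    (le_refl ε₁) hε₁0 hq
  have hr0 : ∀ v : JSite b d N, 0 ≤ W.jrar v := fun v => by
    rcases v with e | X
    · simp
    · simpa using W.rAct_nonneg X.1
  have hKP : ∀ c : CoarseIdx μc, ∑ v ∈ Finset.univ.filter (fun v : JSite b d N => c ∈ jterr cell v),
      W.jrar v * Real.exp (lam * (jterr cell v).card) ≤ q₀ := fun c => by
    refine (W.kp_sum_jrar_le cell hK0 hK hgeo hlam hκlam hη hη1 hW c).trans ?_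
    have h1 : 2 * (1 + Real.exp 2) * K * η ≤ 2 * (1 + Real.exp 2) * η₀ := by
      have : 0 ≤ 2 * (1 + Real.exp 2) := by positivity
      nlinarith
    have h2 : 2 * (1 + Real.exp 2) * η₀ ≤ q₀ := by
      rw [le_div_iff₀ (by positivity)] at hη₀q; linarith
    linarith
  have hMR := W.markRarity_jointSpec ρ hρ (b := b) β
  have hcore := hyp (jcell cell) (jterr (b := b) cell) jact (W.jointSpec ρ β) (jgood good)
    (W.jointMeasure ρ β) ε' q₀ W.jrar hμ hγ hν hspin (fun v => measurableSet_jact v) hHM hε'0 hε's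
    hHF hq₀.le le_rfl hr0 hHP hMR hKP
  have := W.abs_cov_le_of_joint_cov ρ hρ β cell
    (B := fun Δf Δg D => C * Real.exp (Δf.card) * Δg.card * Real.exp (-(κₑ * D)))
    (fun F H Δf Δg Bf Bg D hF hH hFB hHB hFd hHd hD' => by
      have h := hcore F H Δf Δg Bf Bg D hF hH hFB hHB hFd hHd hD'
      calc _ ≤ C * Bf * Bg * Real.exp (Δf.card) * Δg.card * Real.exp (-(κₑ * D)) := h
        _ = Bf * Bg * (C * Real.exp (Δf.card) * Δg.card * Real.exp (-(κₑ * D))) := by ring)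
    f g Δf Δg Bf Bg D hf hg hfB hgB hfdep hgdep hD
  calc _ ≤ Bf * Bg * (C * Real.exp (Δf.card) * Δg.card * Real.exp (-(κₑ * D))) := this
    _ = C * Bf * Bg * Real.exp (Δf.card) * Δg.card * Real.exp (-(κₑ * D)) := by ring

end QuasiLocalGaugePerturbation

end Literature.MathematicalPhysics.QuantumFieldTheory

end
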